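import Summits.QuantumFields.YangMills.Theorems.OneCertifiedCubeContinuumLimitExistsUvBounds345
import Summits.QuantumFields.YangMills.Theorems.ComplexCouplingChannelContinuumLegGivenGapArraysReductionPTU

/-!
# `ContinuumLimitExists` (stmt-QuantumFields-16124), line `birth` v7: the ∃-stub in ONE-BODY form — PTU discharged

Glue for the reshape v6 → v7 of the registered skeleton `Cruxes/ContinuumLimitExists/Lines/birth.lean` (continuation lead c3,
2026-08-17).  The Whitney / grid-shift / nuclear step PTU `PolyVolumeGrowth sch → ProductBound r sch → UUVB r sch` — the
hypothesis `hPTU` of the c3 chessboard reduction (`…UvBoundsOfArrayExponent`, p164124; `…UvBounds345`, p165122) — is now a TREE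
THEOREM: the sibling chain of crux stmt-QuantumFields-15828 (line `alternating-curvature-arrays`, lead c14 and its workers) has
landed all four registered pieces `stub_ptuGeometry`, `stub_ptuDerivatives`, `stub_ptuAnalysis`, `stub_ptuAssembly`
(`Theorems/ComplexCouplingChannelContinuumLegGivenGapStubPtu{Geometry,Derivatives,Analysis,Assembly}.lean`) and their composition
`ContinuumLegGivenGap.arrays_productToUniform` (`…ArraysReductionPTU.lean`) — verbatim PTU (= 15828's former stub `stub_productToUniform`).

Hence the constructive ∃-leg of E can be REGISTERED in one-body form (v7 ∃-stub `stub_cbBounds345`):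

  `∀ G compact simple, ∃ r sch, weak ∧ PVG ∧ (∀ᶠ k, IsTriadic (sch.L k)) ∧ CB(r, sch) ∧ Rot345 ∧ ND2 ∧ ND3`,

`CB(r, sch)` the `k`-uniform one-body array-exponent bound `arrayRoot r β_k a_k L_k m v z₀ q f ≤ C·max(ℓ,ℓ⁻¹)^p·cellNorm s ℓ f`
along the scheme's own tori.  This file (sorry-free, no definitions):
* `uvBounds345_of_cbBounds345` — the v6 ∃-stub statement (… ∧ UUVB ∧ …) from the v7 one (registered glue anchor);
* `continuumLimitExists_of_cbBounds345` — the crux BY NAME from the two v7 stub STATEMENTS (`stub_cbBounds345`, `stub_coreClustering`):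
  the v7 composition as a tree theorem (registered glue anchor; `--glue-by` candidate).
Tightness of the v7 ∃-stub: `…Negative.OvercooledTriadicArrayExponent.exists_degenerate_triadic_scheme_cb` (p166588) — a totally
degenerate weak-coupling triadic scheme has CB ∧ Rot345 (∧ ConvProducts ∧ CoreClustering) and ¬ND2 ∧ ¬ND3: the floors stay load-bearing.
-/

set_option autoImplicit false

noncomputable section

namespace Summit.QuantumFields.YangMills.Cruxes.ContinuumLimitExists.Birth

open scoped SchwartzMap
open Filter Topology MeasureTheory
open Literature.MathematicalPhysics.QuantumFieldTheory Literature.MathematicalPhysics.QuantumLattice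
  Literature.MathematicalPhysics.AQFT Literature.Probability.LatticeModels
open Summit.QuantumFields.YangMills.Cruxes.ContinuumLimitOnTrajectory.TwoOrbitSynchronisation
open Summit.QuantumFields.YangMills.Theorems.ContinuumLegGivenGap (arrays_productToUniform)
open Summit.QuantumFields.YangMills.Theorems.ContinuumLegGivenGap.AlternatingArrays

/-- **The v6 ∃-stub statement from the v7 (one-body) one**: `uvBounds345_of_arrayExponent` (p165122) with PTU discharged by
`ContinuumLegGivenGap.arrays_productToUniform`.  Registered glue anchor of stmt-QuantumFields-16124. [folklore] -/
theorem uvBounds345_of_cbBounds345 :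
    (∀ (G : Type) [Group G] [TopologicalSpace G] [IsTopologicalGroup G] [CompactSpace G]
      [MeasurableSpace G] [BorelSpace G], IsCompactSimpleLieGroup G →
      ∃ (r : LatticeRep G) (sch : SpeciesScheme (YMSpecies G)),
        sch.HasWeakCouplingLimit ∧ PolyVolumeGrowth sch ∧ (∀ᶠ k in atTop, IsTriadic (sch.L k)) ∧
        (∃ (C : ℝ) (p s k₀ : ℕ), 0 ≤ C ∧
          ∀ k : ℕ, k₀ ≤ k → ∀ (m : ℕ) (v z₀ : Fin 4 → ℤ) (q : PlaqIdx)
            (f : SchwartzMap (EuclideanSpace ℝ (Fin 4)) ℝ),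
            LevelAdmissible (sch.L k) m → CellInHalfBox (sch.L k) m v z₀ →
            tsupport f ⊆ physCore (sch.a k) m v z₀ →
            arrayRoot r (sch.β k) (sch.a k) (sch.L k) m v z₀ q f ≤
              C * max (sch.a k * cellSide m) (sch.a k * cellSide m)⁻¹ ^ p *
                cellNorm s (sch.a k * cellSide m) f) ∧
        Rot345 r sch ∧ ND2 r sch ∧ ND3 r sch) →
    ∀ (G : Type) [Group G] [TopologicalSpace G] [IsTopologicalGroup G] [CompactSpace G]
      [MeasurableSpace G] [BorelSpace G], IsCompactSimpleLieGroup G →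
      ∃ (r : LatticeRep G) (sch : SpeciesScheme (YMSpecies G)),
        sch.HasWeakCouplingLimit ∧ PolyVolumeGrowth sch ∧ UUVB r sch ∧ Rot345 r sch ∧ ND2 r sch ∧ ND3 r sch :=
  uvBounds345_of_arrayExponent arrays_productToUniform

/-- **The v7 composition of line `birth` as a tree theorem**: the crux BY NAME from the two v7 stub STATEMENTS — the one-body
∃-stub `stub_cbBounds345` and the E4 ∀-stub `stub_coreClustering` — by `continuumLimitExists_of_cbStubs345` (p165122) with PTU
discharged.  Registered glue anchor of stmt-QuantumFields-16124 (the `--glue-by` decl if the planner promotes the two stubs to items). [folklore] -/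
theorem continuumLimitExists_of_cbBounds345 :
    (∀ (G : Type) [Group G] [TopologicalSpace G] [IsTopologicalGroup G] [CompactSpace G]
      [MeasurableSpace G] [BorelSpace G], IsCompactSimpleLieGroup G →
      ∃ (r : LatticeRep G) (sch : SpeciesScheme (YMSpecies G)),
        sch.HasWeakCouplingLimit ∧ PolyVolumeGrowth sch ∧ (∀ᶠ k in atTop, IsTriadic (sch.L k)) ∧
        (∃ (C : ℝ) (p s k₀ : ℕ), 0 ≤ C ∧
          ∀ k : ℕ, k₀ ≤ k → ∀ (m : ℕ) (v z₀ : Fin 4 → ℤ) (q : PlaqIdx)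
            (f : SchwartzMap (EuclideanSpace ℝ (Fin 4)) ℝ),
            LevelAdmissible (sch.L k) m → CellInHalfBox (sch.L k) m v z₀ →
            tsupport f ⊆ physCore (sch.a k) m v z₀ →
            arrayRoot r (sch.β k) (sch.a k) (sch.L k) m v z₀ q f ≤
              C * max (sch.a k * cellSide m) (sch.a k * cellSide m)⁻¹ ^ p *
                cellNorm s (sch.a k * cellSide m) f) ∧
        Rot345 r sch ∧ ND2 r sch ∧ ND3 r sch) →
    (∀ (G : Type) [Group G] [TopologicalSpace G] [IsTopologicalGroup G] [CompactSpace G]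
      [MeasurableSpace G] [BorelSpace G], IsCompactSimpleLieGroup G →
      ∀ (r : LatticeRep G) (sch : SpeciesScheme (YMSpecies G)),
        sch.HasWeakCouplingLimit → PolyVolumeGrowth sch → ConvProducts r sch → UUVB r sch →
          CoreClustering r sch) →
    Summit.QuantumFields.YangMills.Theses.OneCertifiedCube.ContinuumLimitExists :=
  continuumLimitExists_of_cbStubs345 arrays_productToUniform

end Summit.QuantumFields.YangMills.Cruxes.ContinuumLimitExists.Birth

end
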